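import Literature.MathematicalPhysics.QuantumLattice.PairCorrelations
import Literature.MathematicalPhysics.QuantumLattice.FermionOperatorsProofs
import Literature.MathematicalPhysics.QuantumLattice.FermionOperatorsSpinHermitianProofs
import Literature.Probability.LatticeModels.TorusFourierProofs
import HarnessLib

/-!
# Momentum-resolved pair field and the pair structure factor on the fermionic torus

Topic `Literature/MathematicalPhysics/QuantumLattice` (definition request `defn-pairFieldAt`, wanted
by route `HubbardSuperconductivity/KacWindowPenalty`, items `stmt-HubbardSuperconductivity-1087/1088/
1089`, and by the cards `yrast-landau-ir-step` / `sum-rule-ceiling`). Companion of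
`PairCorrelations.lean`, which owns the local singlet pair operator `localPair g L x = P_x` and the
zero-momentum pair field `pairField g L = Σ_x P_x` on the fermionic torus `(ℤ/Lℤ)²`.

## Contents

* `pairFieldAt g L m = Σ_x e^{-2πi (m·x)/L} P_x` — the Fourier mode `Δ_g(q_m)` of the local pair
  operator at the momentum label `m ∈ (ℤ/Lℤ)²` (`q_m = 2πm/L`), with Mathlib's `ZMod.dft` sign
  convention and NO `|Λ|^{-1/2}` normalisation; the phase is computed through the `ZMod L`-valued
  dot product `Σᵢ mᵢ xᵢ`, so it is well defined on the torus. The body is LITERALLY the term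
  inlined as `let D := fun m => …` in the KacWindowPenalty route, so `D = pairFieldAt dWaveFormFactor L`
  holds by `rfl`.
* `exp_neg_dotProduct_eq_conj_torusChar` — that phase is `conj χ_m(x)` for the torus character
  `torusChar` of `TorusFourierProofs`; hence `pairFieldAt_eq_sum_torusChar`,
  `pairFieldAt_zero : pairFieldAt g L 0 = pairField g L`, `pairFieldAt_conjTranspose`.
* Plancherel for operator-valued Fourier modes, `sum_conjTranspose_mul_fourierMode`
  (`Σ_m A(m)ᴴ A(m) = L^d Σ_x A_xᴴ A_x` for `A(m) = Σ_x conj χ_m(x) A_x`, any family `A_x` of square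
  matrices), and its specialisations `sum_conjTranspose_pairFieldAt_mul_self`,
  `sum_star_pairFieldAt_mulVec_dotProduct` (the pair SUM RULE `Σ_m ‖Δ_g(m)ψ‖² = L² Σ_x ‖P_x ψ‖²`).
* `pairStructureFactor g L ψ m = ‖Δ_g(m) ψ‖² / L²` (`= L⁻² ⟨ψ, Δ_g(m)ᴴ Δ_g(m) ψ⟩`,
  `pairStructureFactor_eq_expect`), nonnegative, with `pairStructureFactor_zero` (the `m = 0` mode is
  `L⁻² ⟨Δ_gᴴ Δ_g⟩`, the quantity of `hasPairFieldLRO_iff_liminf`) and the sum rule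
  `sum_pairStructureFactor : Σ_m S_ψ(m) = Σ_x ‖P_x ψ‖²`.
* `momentumNormSq L m = (2π/L)² Σᵢ (valMinAbs mᵢ)²` — `|q_m|²` for the Brillouin-zone representative
  `q_m ∈ (-π, π]^d` (the route's window condition is `momentumNormSq L m ≤ ε²`, definitionally).
* Symmetry bookkeeping from the CAR: `[N, Δ_g(m)] = -2 Δ_g(m)` (`totalNumber_commutator_pairFieldAt`),
  `[S^z, Δ_g(m)] = 0` (`spinZ_commute_pairFieldAt`), hence `Δ_g(m)ᴴ Δ_g(m)` commutes with the particle
  number and with `S^z` (`totalNumber_commute_conjTranspose_pairFieldAt_mul_self`,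
  `spinZ_commute_conjTranspose_pairFieldAt_mul_self`): momentum-window pair penalties preserve the
  sectors `szSector N M`.

## Sources

T. Kennedy, E. H. Lieb, B. S. Shastry, PRL **61** (1988) 2582, p. 2582 (Fourier modes
`Ŝ_p = |Λ|^{-1/2} Σ_x S_x e^{ip·x}` of an order operator, `g_p = ⟨Ŝ_p Ŝ_{-p}⟩`, and the Parseval sum
rule `|Λ|⁻¹ Σ_p g_p = ⟨(S_0)²⟩`) [KLS1988PRL]; D. J. Scalapino, Phys. Rep. **250** (1995) 329, §2 (the
`d_{x²-y²}` pair field and its equal-time correlations) [Scalapino1995]; S. Friedli, Y. Velenik,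
*Statistical Mechanics of Lattice Systems* (2017), §10.4 (Fourier analysis on `(ℤ/Lℤ)^d`).

## Mathlib / tree search

Mathlib: `ZMod.stdAddChar`, `ZMod.toCircle_apply` (`e(j) = exp(2πi j.val/N)`), `ZMod.dft` (`d = 1`,
same sign), `AddChar.map_add_eq_mul`; no multi-dimensional DFT, no operator-valued Plancherel.
Tree (`lean search`): `torusChar`, `sum_torusChar_left` (orthogonality), `torusChar_sub_right`
(`TorusFourierProofs`); `localPair`, `pairField` (`PairCorrelations`); `number_pair_commutator`,
`totalNumber_commutator_pairCreation` (`FermionOperatorsProofs`); `HubbardWave0.spinZ_isHermitian`.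
Nothing momentum-resolved for pair operators existed (`DWaveSource` is the `q = 0` source,
`ShastryPairingInequalities.uniformOnSitePair` the `q = 0` on-site field).

## Design notes / deliberately not here

* `d = 2` only for `pairFieldAt` / `pairStructureFactor` (as `localPair`); the character lemmas,
  the operator Plancherel and `momentumNormSq` are stated for general `d`.
* Translation covariance `T_a Δ_g(m) T_a⁻¹ = χ_m(a) Δ_g(m)` is NOT provided: the tree has no fermionic
  translation unitaries on `Fock (Orb (FermionTorus d L))` (Jordan–Wigner signs), and none is
  defined here.
* No window penalty / window tail is named here (they stay route-side `let`s); with the present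
  names they read `W_ε = Σ_{m : momentumNormSq L m ≤ ε²} (L²)⁻¹ • (Δ_d(m)ᴴ Δ_d(m))` and
  `T_ε(ψ) = Σ_{m ≠ 0, momentumNormSq L m ≤ ε²} pairStructureFactor dWaveFormFactor L ψ m`.
-/

noncomputable section

namespace Literature.MathematicalPhysics.QuantumLattice

open Matrix Finset Literature.Probability.LatticeModels HubbardWave0
open scoped ComplexOrder ComplexConjugate

/-! ### The momentum phase as a conjugate torus character -/

section Phase

variable {d L : ℕ} [NeZero L]

/-- The standard additive character turns sums into products:
`e(Σᵢ aᵢ) = Πᵢ e(aᵢ)` (iterated `AddChar.map_add_eq_mul`). [folklore] -/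
theorem stdAddChar_sum {ι : Type*} (s : Finset ι) (f : ι → ZMod L) :
    (ZMod.stdAddChar (∑ i ∈ s, f i) : ℂ) = ∏ i ∈ s, (ZMod.stdAddChar (f i) : ℂ) := by
  classical
  induction s using Finset.induction_on with
  | empty => simp
  | insert a s ha ih => rw [Finset.sum_insert ha, Finset.prod_insert ha, AddChar.map_add_eq_mul, ih]

/-- The torus character is the standard character of the `ZMod L`-valued dot product:
`χ_m(x) = e(Σᵢ mᵢ xᵢ)`. Friedli–Velenik (2017) §10.4. [folklore] -/
theorem torusChar_eq_stdAddChar_sum (m x : TorusSite d L) :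
    torusChar m x = ZMod.stdAddChar (∑ i, m i * x i) := by
  rw [torusChar, stdAddChar_sum]

/-- **The momentum phase is a conjugate character.** For momentum label `m` and site `x` of
`(ℤ/Lℤ)^d`, `exp(-2πi · (Σᵢ mᵢ xᵢ).val / L) = conj χ_m(x)`; the left-hand side is the kernel of
Mathlib's `ZMod.dft` evaluated on the `ZMod L`-valued dot product (well defined on the torus because
the dot product is reduced mod `L` before taking the representative `val`).
Friedli–Velenik (2017) §10.4; Mathlib `ZMod.toCircle_apply`. [folklore] -/
theorem exp_neg_dotProduct_eq_conj_torusChar (m x : TorusSite d L) :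
    Complex.exp (-(2 * Real.pi * Complex.I * (((∑ i, m i * x i).val : ℕ) : ℂ) / (L : ℂ))) =
      conj (torusChar m x) := by
  rw [torusChar_eq_stdAddChar_sum, ZMod.stdAddChar_apply, ZMod.toCircle_apply, ← Complex.exp_conj]
  congr 1
  simp only [map_div₀, map_mul, map_natCast, Complex.conj_ofReal, Complex.conj_I, map_ofNat]
  ring

/-- **Plancherel for operator-valued Fourier modes on `(ℤ/Lℤ)^d`.** For any family `A_x` of square
complex matrices indexed by the torus and `A(m) := Σ_x conj χ_m(x) • A_x`,
`Σ_m A(m)ᴴ A(m) = L^d • Σ_x A_xᴴ A_x` (expand and use the orthogonality `Σ_m χ_m(x - y) = L^d δ_{xy}`,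
`sum_torusChar_left`). This is the operator form of the Parseval identity behind the
Kennedy–Lieb–Shastry sum rule `|Λ|⁻¹ Σ_p g_p = ⟨(S_0)²⟩`. [cite: KLS1988PRL, p. 2582] -/
theorem sum_conjTranspose_mul_fourierMode {n : Type*} [Fintype n]
    (A : TorusSite d L → Matrix n n ℂ) :
    ∑ m : TorusSite d L, (∑ x, conj (torusChar m x) • A x)ᴴ * (∑ y, conj (torusChar m y) • A y) =
      ((L : ℂ) ^ d) • ∑ x, (A x)ᴴ * A x := by
  have hH : ∀ m : TorusSite d L,
      (∑ x, conj (torusChar m x) • A x)ᴴ = ∑ x, torusChar m x • (A x)ᴴ := by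
    intro m
    simp only [conjTranspose_sum, conjTranspose_smul, starRingEnd_apply, star_star]
  have hm : ∀ m : TorusSite d L,
      (∑ x, torusChar m x • (A x)ᴴ) * (∑ y, conj (torusChar m y) • A y) =
        ∑ x, ∑ y, torusChar m (x - y) • ((A x)ᴴ * A y) := by
    intro m
    rw [Finset.sum_mul_sum]
    refine Finset.sum_congr rfl fun x _ => Finset.sum_congr rfl fun y _ => ?_
    rw [smul_mul_assoc, mul_smul_comm, smul_smul, ← torusChar_sub_right]
  simp_rw [hH, hm]
  rw [Finset.sum_comm, Finset.smul_sum]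
  refine Finset.sum_congr rfl fun x _ => ?_
  rw [Finset.sum_comm]
  simp_rw [← Finset.sum_smul, sum_torusChar_left, sub_eq_zero, ite_smul, zero_smul]
  rw [Finset.sum_ite_eq, if_pos (Finset.mem_univ x)]

/-- `⟨M ψ, N ψ⟩ = ⟨ψ, (Mᴴ N) ψ⟩` in the `dotProduct` language of the tree
(`star (M ψ) ⬝ᵥ (N ψ) = star ψ ⬝ᵥ (Mᴴ N) ψ`). [folklore] -/
theorem star_mulVec_dotProduct_mulVec {n : Type*} [Fintype n] (M N : Matrix n n ℂ) (ψ : n → ℂ) :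
    star (M *ᵥ ψ) ⬝ᵥ (N *ᵥ ψ) = star ψ ⬝ᵥ ((Mᴴ * N) *ᵥ ψ) := by
  rw [star_mulVec, ← dotProduct_mulVec, mulVec_mulVec]

/-- The squared Euclidean norm `|q_m|²` of the Brillouin-zone momentum attached to the label
`m ∈ (ℤ/Lℤ)^d`: `q_m = (2π/L) · (valMinAbs m₁, …, valMinAbs m_d) ∈ (-π, π]^d`, using the
representative of least absolute value (`ZMod.valMinAbs`), so that momenta near `2π` count as
SMALL — unlike `latticeMomentum L m ∈ [0, 2π)^d`, which uses `val`. Junk value `0` at `L = 0`.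
Friedli–Velenik (2017) §10.4 (lattice momenta `2πm/L`). [folklore] -/
def momentumNormSq (L : ℕ) (m : TorusSite d L) : ℝ :=
  (2 * Real.pi / (L : ℝ)) ^ 2 * ∑ i, (((m i).valMinAbs : ℤ) : ℝ) ^ 2

omit [NeZero L] in
/-- `momentumNormSq` unfolded. [folklore] -/
theorem momentumNormSq_apply (m : TorusSite d L) :
    momentumNormSq L m = (2 * Real.pi / (L : ℝ)) ^ 2 * ∑ i, (((m i).valMinAbs : ℤ) : ℝ) ^ 2 := rfl

omit [NeZero L] in
/-- `|q_m|² ≥ 0`. [folklore] -/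
theorem momentumNormSq_nonneg (m : TorusSite d L) : 0 ≤ momentumNormSq L m :=
  mul_nonneg (sq_nonneg _) (Finset.sum_nonneg fun _ _ => sq_nonneg _)

omit [NeZero L] in
/-- `|q_0|² = 0`. [folklore] -/
@[simp] theorem momentumNormSq_zero : momentumNormSq L (0 : TorusSite d L) = 0 := by
  simp [momentumNormSq]

/-- For `L ≠ 0`, `|q_m|² = 0` only at the zero momentum label. [folklore] -/
theorem momentumNormSq_eq_zero_iff (m : TorusSite d L) : momentumNormSq L m = 0 ↔ m = 0 := by
  refine ⟨fun h => ?_, fun h => by rw [h, momentumNormSq_zero]⟩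
  have hL : (0 : ℝ) < L := Nat.cast_pos.2 (Nat.pos_of_ne_zero (NeZero.ne L))
  have hc : (2 * Real.pi / (L : ℝ)) ^ 2 ≠ 0 := pow_ne_zero _ (div_pos (by positivity) hL).ne'
  rw [momentumNormSq, mul_eq_zero, or_iff_right hc,
    Finset.sum_eq_zero_iff_of_nonneg fun i _ => sq_nonneg _] at h
  funext i
  have hi := h i (Finset.mem_univ i)
  rw [sq_eq_zero_iff, Int.cast_eq_zero, ZMod.valMinAbs_eq_zero] at hi
  exact hi

end Phase

/-! ### The momentum-resolved pair field `Δ_g(m)` -/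

section Torus

variable (g : Site 2 → ℝ) (L : ℕ) [NeZero L]

/-- **The momentum-resolved pair field** with form factor `g` on the fermionic torus `(ℤ/Lℤ)²`:
for a momentum label `m ∈ (ℤ/Lℤ)²` (momentum `q_m = 2πm/L`),
`Δ_g(m) = Σ_x e^{-2πi (m·x)/L} P_x`, `P_x = localPair g L x` the local singlet pair annihilator of
Scalapino's pair field; `Δ_g(0) = pairField g L` (`pairFieldAt_zero`). This is the Fourier mode of
the order operator in the sense of Kennedy–Lieb–Shastry (`Ŝ_p = |Λ|^{-1/2} Σ_x e^{ip·x} S_x`), here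
UNNORMALISED (no `|Λ|^{-1/2} = L⁻¹`) and with the minus sign of Mathlib's `ZMod.dft`; the phase is
`conj χ_m(x)` (`pairFieldAt_eq_sum_torusChar`). The body is verbatim the `let D := …` of route
KacWindowPenalty. Scalapino, Phys. Rep. 250 (1995) 329, §2 (pair field);
Kennedy–Lieb–Shastry, PRL 61 (1988) 2582 (Fourier modes). [cite: KLS1988PRL, p. 2582] -/
def pairFieldAt (m : TorusSite 2 L) :
    Matrix (Finset (Orb (FermionTorus 2 L))) (Finset (Orb (FermionTorus 2 L))) ℂ :=
  ∑ x : Fin 2 → ZMod L,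
    Complex.exp (-(2 * Real.pi * Complex.I * (((∑ i : Fin 2, m i * x i).val : ℕ) : ℂ) / (L : ℂ))) •
      localPair g L x

/-- `pairFieldAt` unfolded (the literal route expression). [folklore] -/
theorem pairFieldAt_def (m : TorusSite 2 L) :
    pairFieldAt g L m = ∑ x : Fin 2 → ZMod L,
      Complex.exp (-(2 * Real.pi * Complex.I * (((∑ i : Fin 2, m i * x i).val : ℕ) : ℂ) / (L : ℂ))) •
        localPair g L x := rfl

/-- `Δ_g(m) = Σ_x conj χ_m(x) • P_x` with the torus character `χ_m` of `TorusFourierProofs`.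
Friedli–Velenik (2017) §10.4. [folklore] -/
theorem pairFieldAt_eq_sum_torusChar (m : TorusSite 2 L) :
    pairFieldAt g L m = ∑ x, conj (torusChar m x) • localPair g L x := by
  simp only [pairFieldAt, exp_neg_dotProduct_eq_conj_torusChar]

/-- The zero mode is the pair field: `Δ_g(0) = Σ_x P_x = pairField g L`.
Scalapino, Phys. Rep. 250 (1995) 329, §2. [folklore] -/
@[simp] theorem pairFieldAt_zero : pairFieldAt g L 0 = pairField g L := by
  rw [pairFieldAt_eq_sum_torusChar]
  simp [pairField]

/-- `Δ_g(m)ᴴ = Σ_x χ_m(x) • P_xᴴ`. [folklore] -/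
theorem pairFieldAt_conjTranspose (m : TorusSite 2 L) :
    (pairFieldAt g L m)ᴴ = ∑ x, torusChar m x • (localPair g L x)ᴴ := by
  rw [pairFieldAt_eq_sum_torusChar]
  simp only [conjTranspose_sum, conjTranspose_smul, starRingEnd_apply, star_star]

/-- **Operator sum rule**: `Σ_m Δ_g(m)ᴴ Δ_g(m) = L² • Σ_x P_xᴴ P_x` (Plancherel on `(ℤ/Lℤ)²`,
`sum_conjTranspose_mul_fourierMode`). Kennedy–Lieb–Shastry, PRL 61 (1988) 2582 (Parseval sum
rule). [cite: KLS1988PRL, p. 2582] -/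
theorem sum_conjTranspose_pairFieldAt_mul_self :
    ∑ m, (pairFieldAt g L m)ᴴ * pairFieldAt g L m =
      ((L : ℂ) ^ 2) • ∑ x, (localPair g L x)ᴴ * localPair g L x := by
  simp_rw [pairFieldAt_eq_sum_torusChar]
  exact sum_conjTranspose_mul_fourierMode (localPair g L)

/-- **Pair sum rule, vector form**: `Σ_m ‖Δ_g(m) ψ‖² = L² Σ_x ‖P_x ψ‖²` for every Fock vector `ψ`
(in `dotProduct` form). Kennedy–Lieb–Shastry, PRL 61 (1988) 2582. [cite: KLS1988PRL, p. 2582] -/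
theorem sum_star_pairFieldAt_mulVec_dotProduct (ψ : Fock (Orb (FermionTorus 2 L))) :
    ∑ m, star (pairFieldAt g L m *ᵥ ψ) ⬝ᵥ (pairFieldAt g L m *ᵥ ψ) =
      (L : ℂ) ^ 2 * ∑ x, star (localPair g L x *ᵥ ψ) ⬝ᵥ (localPair g L x *ᵥ ψ) := by
  have h := congrArg (fun T => star ψ ⬝ᵥ (T *ᵥ ψ)) (sum_conjTranspose_pairFieldAt_mul_self g L)
  simp only [sum_mulVec, dotProduct_sum, smul_mulVec, dotProduct_smul, smul_eq_mul] at h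
  simp_rw [star_mulVec_dotProduct_mulVec]
  exact h

/-! ### The pair structure factor -/

/-- **The pair structure factor** of a Fock vector `ψ` at momentum label `m`:
`S_ψ(m) = ‖Δ_g(m) ψ‖² / L² = L⁻² ⟨ψ, Δ_g(m)ᴴ Δ_g(m) ψ⟩` (`pairStructureFactor_eq_expect`), i.e. the
expectation in `ψ` of `Δ̂ᴴ Δ̂` for the normalised Fourier mode `Δ̂ = |Λ|^{-1/2} Δ_g(m)`, `|Λ| = L²` —
the pair-operator analogue of Kennedy–Lieb–Shastry's `g_p = ⟨Ŝ_p Ŝ_{-p}⟩` (for their Hermitian spin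
operators `Ŝ_{-p} = Ŝ_pᴴ`). Written with `re` (the number is real and nonnegative,
`pairStructureFactor_nonneg`) exactly as the window-tail summand of route KacWindowPenalty.
Kennedy–Lieb–Shastry, PRL 61 (1988) 2582, p. 2582. [cite: KLS1988PRL, p. 2582] -/
def pairStructureFactor (ψ : Fock (Orb (FermionTorus 2 L))) (m : TorusSite 2 L) : ℝ :=
  (star (pairFieldAt g L m *ᵥ ψ) ⬝ᵥ (pairFieldAt g L m *ᵥ ψ)).re / (L : ℝ) ^ 2

/-- `pairStructureFactor` unfolded. [folklore] -/
theorem pairStructureFactor_apply (ψ : Fock (Orb (FermionTorus 2 L))) (m : TorusSite 2 L) :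
    pairStructureFactor g L ψ m =
      (star (pairFieldAt g L m *ᵥ ψ) ⬝ᵥ (pairFieldAt g L m *ᵥ ψ)).re / (L : ℝ) ^ 2 := rfl

/-- `S_ψ(m) = L⁻² Re ⟨ψ, Δ_g(m)ᴴ Δ_g(m) ψ⟩` (Wave0's `expect`). [folklore] -/
theorem pairStructureFactor_eq_expect (ψ : Fock (Orb (FermionTorus 2 L))) (m : TorusSite 2 L) :
    pairStructureFactor g L ψ m =
      (expect ((pairFieldAt g L m)ᴴ * pairFieldAt g L m) ψ).re / (L : ℝ) ^ 2 := by
  rw [pairStructureFactor, star_mulVec_dotProduct_mulVec]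
  rfl

/-- `S_ψ(m) ≥ 0`. [folklore] -/
theorem pairStructureFactor_nonneg (ψ : Fock (Orb (FermionTorus 2 L))) (m : TorusSite 2 L) :
    0 ≤ pairStructureFactor g L ψ m :=
  div_nonneg (Complex.nonneg_iff.1 (dotProduct_star_self_nonneg _)).1 (sq_nonneg _)

/-- The zero mode of the structure factor is the LRO quantity `L⁻² Re ⟨ψ, Δ_gᴴ Δ_g ψ⟩` of
`hasPairFieldLRO_iff_liminf` (up to the further factor `L⁻²` there).
Scalapino, Phys. Rep. 250 (1995) 329, §2. [folklore] -/
theorem pairStructureFactor_zero (ψ : Fock (Orb (FermionTorus 2 L))) :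
    pairStructureFactor g L ψ 0 =
      (expect ((pairField g L)ᴴ * pairField g L) ψ).re / (L : ℝ) ^ 2 := by
  rw [pairStructureFactor_eq_expect, pairFieldAt_zero]

/-- **Sum rule for the pair structure factor**: `Σ_m S_ψ(m) = Σ_x ‖P_x ψ‖²` (Parseval).
Kennedy–Lieb–Shastry print it, for the translation-invariant ground state, as
`|Λ|⁻¹ Σ_p g_p = ⟨(S_0)²⟩`; no translation invariance of `ψ` is assumed here, so the right-hand side
keeps the site sum. Kennedy–Lieb–Shastry, PRL 61 (1988) 2582. [cite: KLS1988PRL, p. 2582] -/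
theorem sum_pairStructureFactor (ψ : Fock (Orb (FermionTorus 2 L))) :
    ∑ m, pairStructureFactor g L ψ m =
      ∑ x, (star (localPair g L x *ᵥ ψ) ⬝ᵥ (localPair g L x *ᵥ ψ)).re := by
  have hL : (L : ℝ) ^ 2 ≠ 0 := pow_ne_zero _ (Nat.cast_ne_zero.2 (NeZero.ne L))
  simp only [pairStructureFactor]
  rw [← Finset.sum_div, ← Complex.re_sum, sum_star_pairFieldAt_mulVec_dotProduct,
    show ((L : ℂ) ^ 2) = (((L : ℝ) ^ 2 : ℝ) : ℂ) by push_cast; rfl, Complex.re_ofReal_mul,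
    mul_div_cancel_left₀ _ hL, Complex.re_sum]

end Torus

/-! ### Particle number and `S^z`: the CAR bookkeeping -/

section Symmetry

variable {Λ : Type*} [LinearOrder Λ] [Fintype Λ]

/-- The total particle number `N = Σ_{x,σ} n_{xσ}` is Hermitian. Tasaki (2020) §9.3. [folklore] -/
theorem totalNumber_isHermitian :
    (totalNumber : Matrix (Finset (Orb Λ)) (Finset (Orb Λ)) ℂ).IsHermitian := by
  unfold Matrix.IsHermitian totalNumber
  simp only [conjTranspose_sum]
  refine Finset.sum_congr rfl fun x _ => Finset.sum_congr rfl fun σ _ => ?_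
  exact (numberAt_isHermitian (orb x σ)).eq

/-- `[N, c_p c_q] = -2 c_p c_q`: a pair annihilator lowers the particle number by two (adjoint of
`totalNumber_commutator_pairCreation`, `[N, c†_p c†_q] = 2 c†_p c†_q`). Essler et al. (2005)
§2.2.5, eq. (2.87). [folklore] -/
theorem totalNumber_commutator_annihilation_mul_annihilation (p q : Orb Λ) :
    totalNumber * (annihilation p * annihilation q) - annihilation p * annihilation q * totalNumber =
      (-2 : ℂ) • (annihilation p * annihilation q) := by
  have h := congrArg conjTranspose (totalNumber_commutator_pairCreation q p)
  simp only [conjTranspose_sub, conjTranspose_mul, conjTranspose_smul, creation_conjTranspose,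
    totalNumber_isHermitian.eq, star_ofNat] at h
  rw [← neg_sub, h, neg_smul]

/-- Commutator relations `[N, M] = c • M` are stable under finite sums. [folklore] -/
theorem commutator_sum_eq_smul {n : Type*} [Fintype n] {α : Type*} (s : Finset α)
    (N : Matrix n n ℂ) (f : α → Matrix n n ℂ) (c : ℂ)
    (h : ∀ a ∈ s, N * f a - f a * N = c • f a) :
    N * (∑ a ∈ s, f a) - (∑ a ∈ s, f a) * N = c • ∑ a ∈ s, f a := by
  rw [Finset.mul_sum, Finset.sum_mul, ← Finset.sum_sub_distrib, Finset.smul_sum]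
  exact Finset.sum_congr rfl h

/-- Commutator relations `[N, M] = c • M` are stable under scalar multiples. [folklore] -/
theorem commutator_smul_eq_smul {n : Type*} [Fintype n] (N M : Matrix n n ℂ) (a c : ℂ)
    (h : N * M - M * N = c • M) : N * (a • M) - (a • M) * N = c • (a • M) := by
  rw [mul_smul_comm, smul_mul_assoc, ← smul_sub, h, smul_comm]

/-- Commutator relations `[N, M] = c • M` are stable under differences. [folklore] -/
theorem commutator_sub_eq_smul {n : Type*} [Fintype n] (N M M' : Matrix n n ℂ) (c : ℂ)
    (h : N * M - M * N = c • M) (h' : N * M' - M' * N = c • M') :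
    N * (M - M') - (M - M') * N = c • (M - M') := by
  rw [mul_sub, sub_mul, sub_sub_sub_comm, h, h', smul_sub]

/-- If `[N, X] = -2 X` for the (Hermitian) particle number `N`, then `N` commutes with `Xᴴ X`
(`[N, Xᴴ] = +2 Xᴴ` by taking adjoints, and the two shifts cancel). [folklore] -/
theorem totalNumber_commute_conjTranspose_mul_self_of_commutator
    {X : Matrix (Finset (Orb Λ)) (Finset (Orb Λ)) ℂ}
    (h : totalNumber * X - X * totalNumber = (-2 : ℂ) • X) :
    Commute totalNumber (Xᴴ * X) := by
  have h1 : totalNumber * X = X * totalNumber + (-2 : ℂ) • X := sub_eq_iff_eq_add'.1 h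
  have h2' : Xᴴ * totalNumber - totalNumber * Xᴴ = (-2 : ℂ) • Xᴴ := by
    have := congrArg conjTranspose h
    simp only [conjTranspose_sub, conjTranspose_mul, conjTranspose_smul,
      totalNumber_isHermitian.eq, star_neg, star_ofNat] at this
    exact this
  have h2 : totalNumber * Xᴴ = Xᴴ * totalNumber + (2 : ℂ) • Xᴴ := by
    calc totalNumber * Xᴴ = Xᴴ * totalNumber - (Xᴴ * totalNumber - totalNumber * Xᴴ) := by abel
      _ = Xᴴ * totalNumber - (-2 : ℂ) • Xᴴ := by rw [h2']
      _ = Xᴴ * totalNumber + (2 : ℂ) • Xᴴ := by rw [neg_smul, sub_neg_eq_add]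
  calc totalNumber * (Xᴴ * X) = totalNumber * Xᴴ * X := (mul_assoc _ _ _).symm
    _ = (Xᴴ * totalNumber + (2 : ℂ) • Xᴴ) * X := by rw [h2]
    _ = Xᴴ * (totalNumber * X) + (2 : ℂ) • (Xᴴ * X) := by rw [add_mul, mul_assoc, smul_mul_assoc]
    _ = Xᴴ * (X * totalNumber + (-2 : ℂ) • X) + (2 : ℂ) • (Xᴴ * X) := by rw [h1]
    _ = Xᴴ * X * totalNumber := by
      rw [mul_add, mul_smul_comm, ← mul_assoc, neg_smul, add_assoc, neg_add_cancel, add_zero]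

/-- `[S^z, c†_{Xσ} c†_{Yτ}] = 0` for opposite spins `σ ≠ τ` (such a pair carries no `S^z`):
by `number_pair_commutator`, `[n_{zρ}, c†_p c†_q] = (δ_{zρ,p} + δ_{zρ,q}) c†_p c†_q`, and summing
over `z` the `↑` and `↓` contributions are `([σ = ↑] + [τ = ↑]) - ([σ = ↓] + [τ = ↓]) = 0`.
Essler et al. (2005) §2.2.5 (proof of eq. (2.85)); Tasaki (2020) §9.3. [folklore] -/
theorem spinZ_commute_creation_mul_creation {σ τ : Fin 2} (hστ : σ ≠ τ) (X Y : Λ) :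
    Commute (spinZ : Matrix (Finset (Orb Λ)) (Finset (Orb Λ)) ℂ)
      (creation (orb X σ) * creation (orb Y τ)) := by
  have hsum : ∀ (w : Λ) (ρ κ : Fin 2) (M : Matrix (Finset (Orb Λ)) (Finset (Orb Λ)) ℂ),
      (∑ z : Λ, if orb z ρ = orb w κ then M else 0) = if ρ = κ then M else 0 := by
    intro w ρ κ M
    by_cases hρκ : ρ = κ
    · subst hρκ
      rw [if_pos rfl]
      simp_rw [orb_eq_orb_iff, and_true]
      rw [Finset.sum_ite_eq', if_pos (Finset.mem_univ _)]
    · rw [if_neg hρκ]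
      exact Finset.sum_eq_zero fun z _ => if_neg fun h => hρκ (orb_eq_orb_iff.1 h).2
  have key : (∑ z : Λ, (numberOp z 0 - numberOp z 1)) * (creation (orb X σ) * creation (orb Y τ)) -
      creation (orb X σ) * creation (orb Y τ) * ∑ z : Λ, (numberOp z 0 - numberOp z 1) = 0 := by
    rw [Finset.sum_mul, Finset.mul_sum, ← Finset.sum_sub_distrib]
    have hz : ∀ z : Λ, (numberOp z 0 - numberOp z 1) * (creation (orb X σ) * creation (orb Y τ)) -
        creation (orb X σ) * creation (orb Y τ) * (numberOp z 0 - numberOp z 1) =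
        ((if orb z 0 = orb X σ then creation (orb X σ) * creation (orb Y τ) else 0) +
            (if orb z 0 = orb Y τ then creation (orb X σ) * creation (orb Y τ) else 0)) -
          ((if orb z 1 = orb X σ then creation (orb X σ) * creation (orb Y τ) else 0) +
            (if orb z 1 = orb Y τ then creation (orb X σ) * creation (orb Y τ) else 0)) := by
      intro z
      rw [sub_mul, mul_sub, sub_sub_sub_comm, numberOp, numberOp, number_pair_commutator,
        number_pair_commutator]
    rw [Finset.sum_congr rfl fun z _ => hz z, Finset.sum_sub_distrib, Finset.sum_add_distrib,
      Finset.sum_add_distrib, hsum X 0 σ, hsum Y 0 τ, hsum X 1 σ, hsum Y 1 τ]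
    fin_cases σ <;> fin_cases τ <;> simp at hστ ⊢
  rw [Commute, SemiconjBy, spinZ, smul_mul_assoc, mul_smul_comm, ← sub_eq_zero, ← smul_sub, key,
    smul_zero]

/-- `[S^z, c_{Xσ} c_{Yτ}] = 0` for opposite spins `σ ≠ τ` (adjoint of
`spinZ_commute_creation_mul_creation`, `S^z` Hermitian). Tasaki (2020) §9.3. [folklore] -/
theorem spinZ_commute_annihilation_mul_annihilation {σ τ : Fin 2} (hστ : σ ≠ τ) (X Y : Λ) :
    Commute (spinZ : Matrix (Finset (Orb Λ)) (Finset (Orb Λ)) ℂ)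
      (annihilation (orb X σ) * annihilation (orb Y τ)) := by
  have h := congrArg conjTranspose (spinZ_commute_creation_mul_creation (Ne.symm hστ) Y X).eq
  simp only [conjTranspose_mul, creation_conjTranspose, spinZ_isHermitian.eq] at h
  exact h.symm

end Symmetry

section TorusSymmetry

variable (g : Site 2 → ℝ) (L : ℕ) [NeZero L]

/-- `[N, P_x] = -2 P_x` for the local pair operator. Essler et al. (2005) §2.2.5. [folklore] -/
theorem totalNumber_commutator_localPair (x : TorusSite 2 L) :
    totalNumber * localPair g L x - localPair g L x * totalNumber = (-2 : ℂ) • localPair g L x := by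
  unfold localPair
  refine commutator_sum_eq_smul _ _ _ _ fun e _ => commutator_smul_eq_smul _ _ _ _ ?_
  exact commutator_sub_eq_smul _ _ _ _
    (totalNumber_commutator_annihilation_mul_annihilation _ _)
    (totalNumber_commutator_annihilation_mul_annihilation _ _)

/-- `[N, Δ_g(m)] = -2 Δ_g(m)`: the momentum-resolved pair field lowers the particle number by
two. Essler et al. (2005) §2.2.5. [folklore] -/
theorem totalNumber_commutator_pairFieldAt (m : TorusSite 2 L) :
    totalNumber * pairFieldAt g L m - pairFieldAt g L m * totalNumber =
      (-2 : ℂ) • pairFieldAt g L m := by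
  unfold pairFieldAt
  exact commutator_sum_eq_smul _ _ _ _ fun x _ =>
    commutator_smul_eq_smul _ _ _ _ (totalNumber_commutator_localPair g L x)

/-- `Δ_g(m)ᴴ Δ_g(m)` conserves the particle number: `[N, Δ_g(m)ᴴ Δ_g(m)] = 0` (so momentum-window
pair penalties preserve every `N`-particle sector). [folklore] -/
theorem totalNumber_commute_conjTranspose_pairFieldAt_mul_self (m : TorusSite 2 L) :
    Commute totalNumber ((pairFieldAt g L m)ᴴ * pairFieldAt g L m) :=
  totalNumber_commute_conjTranspose_mul_self_of_commutator (totalNumber_commutator_pairFieldAt g L m)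

/-- `[S^z, P_x] = 0`: the local SINGLET pair operator carries no `S^z`. Tasaki (2020) §9.3. [folklore] -/
theorem spinZ_commute_localPair (x : TorusSite 2 L) : Commute spinZ (localPair g L x) := by
  unfold localPair
  refine Commute.sum_right _ _ _ fun e _ => Commute.smul_right ?_ _
  exact (spinZ_commute_annihilation_mul_annihilation zero_ne_one _ _).sub_right
    (spinZ_commute_annihilation_mul_annihilation one_ne_zero _ _)

/-- `[S^z, Δ_g(m)] = 0`. Tasaki (2020) §9.3. [folklore] -/
theorem spinZ_commute_pairFieldAt (m : TorusSite 2 L) : Commute spinZ (pairFieldAt g L m) := by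
  unfold pairFieldAt
  exact Commute.sum_right _ _ _ fun x _ => (spinZ_commute_localPair g L x).smul_right _

/-- `[S^z, Δ_g(m)ᴴ Δ_g(m)] = 0` (so momentum-window pair penalties preserve every `S^z`
eigenspace, hence every joint sector `szSector N M`). [folklore] -/
theorem spinZ_commute_conjTranspose_pairFieldAt_mul_self (m : TorusSite 2 L) :
    Commute spinZ ((pairFieldAt g L m)ᴴ * pairFieldAt g L m) := by
  have h := spinZ_commute_pairFieldAt g L m
  have h' : Commute spinZ (pairFieldAt g L m)ᴴ := by
    have := congrArg conjTranspose h.eq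
    simp only [conjTranspose_mul, spinZ_isHermitian.eq] at this
    exact this.symm
  exact h'.mul_right h

end TorusSymmetry

end Literature.MathematicalPhysics.QuantumLattice
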